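import Literature.MathematicalPhysics.KineticTheory.LambertianRedrawNondegenerate
import Literature.Analysis.FluidPDE.LambertCosineLaw
import Literature.Analysis.FluidPDE.BoltzmannEquation
import Literature.Analysis.FluidPDE.HardSphereScattering
import Mathlib.MeasureTheory.Function.Jacobian

/-!
# The half-angle cosine law: the Lambertian direction of a Gaussian vector is cosine-distributed

Helper file (`--supports`) of the support item `LambertianWellPosed` of route `LambertianContactSwap`
(`AtomisticToContinuum/HydrodynamicLimit`, stmt-AtomisticToContinuum-12101).

For a unit vector `ν ∈ ℝ³` and `ξ` standard Gaussian, the Lambertian direction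
`lambertDir ν ξ = normalize(ν̂ + ξ̂)` (`Literature.MathematicalPhysics.KineticTheory.lambertDir`) has the
cosine (Lambert / Knudsen) law `π⁻¹ ⟪θ, ν⟫₊ dσ(θ)` on the unit sphere:
`∫ f (lambertDir ν ξ) dγ(ξ) = π⁻¹ ∫_{S²} ⟪θ, ν⟫₊ f θ dσ(θ)` (`lintegral_lambertDir_stdGaussian`).

Proof: the quadratic map `((2 * ⟪x, ν⟫_ℝ) • x - ‖x‖ ^ 2 • ν) = 2⟪x, ν⟫ x − ‖x‖² ν` (quaternion squaring restricted to
`span{1, i, j}`) is a bijection from the open half-space `⟪x, ν⟫ > 0` onto `ℝ³` minus a null ray, with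
Jacobian determinant `8 ‖x‖² ⟪x, ν⟫`, and `lambertDir ν (((2 * ⟪x, ν⟫_ℝ) • x - ‖x‖ ^ 2 • ν)) = x̂`; change variables
(`MeasureTheory.lintegral_image_eq_lintegral_abs_det_fderiv_mul`), pass to polar coordinates
(`Literature.Analysis.FluidPDE.lintegral_polar`) and normalise the constant with `f ≡ 1`
(`Literature.Analysis.FluidPDE.lintegral_toSphere_cos`: the total flux is `π`).
-/

noncomputable section

open MeasureTheory ProbabilityTheory Set Function Filter Metric
open scoped ENNReal InnerProductSpace Real

namespace Summit.AtomisticToContinuum.HydrodynamicLimit.Theorems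

open Literature.MathematicalPhysics.KineticTheory Literature.Analysis.FluidPDE
  Literature.Analysis.FluidPDE.Alexander

namespace HalfAngle

variable {V : Type*} [NormedAddCommGroup V] [InnerProductSpace ℝ V]

/-! Throughout, the *square map* of `ν` is `x ↦ 2⟪x, ν⟫ x − ‖x‖² ν` (for unit `ν`: `ν` reflected
across the line of `x`, scaled by `‖x‖²`; quaternion squaring on `span{1, i, j}`), written inline. -/

/-- `‖((2 * ⟪x, ν⟫_ℝ) • x - ‖x‖ ^ 2 • ν)‖ = ‖x‖²` for a unit vector `ν`. [folklore] -/
theorem norm_sqMap {ν : V} (hν : ‖ν‖ = 1) (x : V) : ‖((2 * ⟪x, ν⟫_ℝ) • x - ‖x‖ ^ 2 • ν)‖ = ‖x‖ ^ 2 := by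
  have h : ‖((2 * ⟪x, ν⟫_ℝ) • x - ‖x‖ ^ 2 • ν)‖ ^ 2 = (‖x‖ ^ 2) ^ 2 := by
    rw [norm_sub_sq_real, norm_smul, norm_smul, inner_smul_left, inner_smul_right, hν]
    simp only [Real.norm_eq_abs, RCLike.conj_to_real, mul_one, abs_of_nonneg (sq_nonneg ‖x‖),
      mul_pow, sq_abs]
    ring
  have h0 : 0 ≤ ‖((2 * ⟪x, ν⟫_ℝ) • x - ‖x‖ ^ 2 • ν)‖ := norm_nonneg _
  nlinarith [sq_nonneg (‖((2 * ⟪x, ν⟫_ℝ) • x - ‖x‖ ^ 2 • ν)‖ - ‖x‖ ^ 2), sq_nonneg (‖((2 * ⟪x, ν⟫_ℝ) • x - ‖x‖ ^ 2 • ν)‖ + ‖x‖ ^ 2), sq_nonneg ‖x‖]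

/-- A vector of the open half-space of `ν` is nonzero. [folklore] -/
theorem ne_zero_of_inner_pos {ν x : V} (hx : 0 < ⟪x, ν⟫_ℝ) : x ≠ 0 := fun h => by
  rw [h, inner_zero_left] at hx; exact lt_irrefl _ hx

/-- On the open half-space of `ν`, the bisector of `ν` and the direction of `((2 * ⟪x, ν⟫_ℝ) • x - ‖x‖ ^ 2 • ν)` is along
`x`: `ν + (((2 * ⟪x, ν⟫_ℝ) • x - ‖x‖ ^ 2 • ν))^ = (2⟪x, ν⟫ ‖x‖⁻²) x`. [folklore] -/
theorem bisector_sqMap {ν : V} (hν : ‖ν‖ = 1) {x : V} (hx : 0 < ⟪x, ν⟫_ℝ) :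
    ‖ν‖⁻¹ • ν + ‖((2 * ⟪x, ν⟫_ℝ) • x - ‖x‖ ^ 2 • ν)‖⁻¹ • ((2 * ⟪x, ν⟫_ℝ) • x - ‖x‖ ^ 2 • ν) = (2 * ⟪x, ν⟫_ℝ * (‖x‖ ^ 2)⁻¹) • x := by
  have hn : ‖x‖ ^ 2 ≠ 0 := pow_ne_zero 2 (norm_ne_zero_iff.2 (ne_zero_of_inner_pos hx))
  rw [hν, inv_one, one_smul, norm_sqMap hν, smul_sub, smul_smul, smul_smul,
    inv_mul_cancel₀ hn, one_smul, add_sub_cancel, mul_comm]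

/-- **`lambertDir` inverts `sqMap`**: for `⟪x, ν⟫ > 0`, `lambertDir ν (((2 * ⟪x, ν⟫_ℝ) • x - ‖x‖ ^ 2 • ν)) = x̂`. [folklore] -/
theorem lambertDir_sqMap {ν : V} (hν : ‖ν‖ = 1) {x : V} (hx : 0 < ⟪x, ν⟫_ℝ) :
    lambertDir ν (((2 * ⟪x, ν⟫_ℝ) • x - ‖x‖ ^ 2 • ν)) = ‖x‖⁻¹ • x := by
  have hxn : 0 < ‖x‖ := norm_pos_iff.2 (ne_zero_of_inner_pos hx)
  have hc : 0 < 2 * ⟪x, ν⟫_ℝ * (‖x‖ ^ 2)⁻¹ := by positivity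
  rw [lambertDir, bisector_sqMap hν hx, norm_smul, Real.norm_of_nonneg hc.le, smul_smul]
  congr 1
  field_simp

/-- `sqMap ν` is injective on the open half-space `⟪x, ν⟫ > 0` (unit `ν`). [folklore] -/
theorem injOn_sqMap {ν : V} (hν : ‖ν‖ = 1) : InjOn (fun x : V => (2 * ⟪x, ν⟫_ℝ) • x - ‖x‖ ^ 2 • ν) {x : V | 0 < ⟪x, ν⟫_ℝ} := by
  intro x hx y hy hxy
  simp only at hxy
  have hx' : 0 < ⟪x, ν⟫_ℝ := hx
  have hy' : 0 < ⟪y, ν⟫_ℝ := hy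
  have hdx := lambertDir_sqMap hν hx'
  have hdy := lambertDir_sqMap hν hy'
  rw [hxy, hdy] at hdx
  -- equal norms
  have hnorm : ‖x‖ = ‖y‖ := by
    have h1 := norm_sqMap hν x
    have h2 := norm_sqMap hν y
    rw [hxy, h2] at h1
    exact ((pow_left_inj₀ (norm_nonneg x) (norm_nonneg y) two_ne_zero).1 h1.symm)
  have hxn : ‖x‖ ≠ 0 := norm_ne_zero_iff.2 (ne_zero_of_inner_pos hx')
  have := congrArg (fun v => ‖x‖ • v) hdx
  simp only [smul_smul] at this
  rwa [← hnorm, mul_inv_cancel₀ hxn, one_smul, one_smul, eq_comm] at this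

/-- Unfolding `sqMapDeriv`. [folklore] -/
theorem sqMapDeriv_apply (ν x h : V) :
    ((2 * ⟪x, ν⟫_ℝ) • ContinuousLinearMap.id ℝ V + ((2 : ℝ) • innerSL ℝ ν).smulRight x - ((2 : ℝ) • innerSL ℝ x).smulRight ν) h = (2 * ⟪x, ν⟫_ℝ) • h + (2 * ⟪h, ν⟫_ℝ) • x - (2 * ⟪x, h⟫_ℝ) • ν := by
  simp [ContinuousLinearMap.smulRight_apply, innerSL_apply_apply, real_inner_comm ν h]

/-- `sqMap ν` has derivative `sqMapDeriv ν x` at `x`. [folklore] -/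
theorem hasFDerivAt_sqMap (ν x : V) : HasFDerivAt (fun x : V => (2 * ⟪x, ν⟫_ℝ) • x - ‖x‖ ^ 2 • ν) ((2 * ⟪x, ν⟫_ℝ) • ContinuousLinearMap.id ℝ V + ((2 : ℝ) • innerSL ℝ ν).smulRight x - ((2 : ℝ) • innerSL ℝ x).smulRight ν) x := by
  have h1 : HasFDerivAt (fun y : V => ⟪y, ν⟫_ℝ) (innerSL ℝ ν) x := by
    have heq : (fun y : V => ⟪y, ν⟫_ℝ) = innerSL ℝ ν := by
      ext y; simp [innerSL_apply_apply, real_inner_comm]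
    rw [heq]
    exact (innerSL ℝ ν).hasFDerivAt
  have h2 : HasFDerivAt (fun y : V => (2 * ⟪y, ν⟫_ℝ) • y)
      ((2 * ⟪x, ν⟫_ℝ) • ContinuousLinearMap.id ℝ V + ((2 : ℝ) • innerSL ℝ ν).smulRight x) x :=
    (h1.const_mul (2 : ℝ)).smul (hasFDerivAt_id x)
  have h3' : HasFDerivAt (fun y : V => ‖y‖ ^ 2) ((2 : ℝ) • innerSL ℝ x) x := by
    have := (hasStrictFDerivAt_norm_sq x).hasFDerivAt
    rwa [← Nat.cast_smul_eq_nsmul ℝ (2 : ℕ), Nat.cast_ofNat] at this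
  exact h2.sub (h3'.smul_const ν)

/-! ## Surjectivity onto the complement of a null set -/

/-- The bisector has squared norm twice its component along `ν`: `‖ν + ξ̂‖² = 2⟪ν + ξ̂, ν⟫` (unit `ν`,
`ξ ≠ 0`). [folklore] -/
theorem norm_sq_bisector {ν ξ : V} (hν : ‖ν‖ = 1) (hξ : ξ ≠ 0) :
    ‖‖ν‖⁻¹ • ν + ‖ξ‖⁻¹ • ξ‖ ^ 2 = 2 * ⟪‖ν‖⁻¹ • ν + ‖ξ‖⁻¹ • ξ, ν⟫_ℝ := by
  have hξn : ‖ξ‖ ≠ 0 := norm_ne_zero_iff.2 hξ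
  have hu : ‖‖ξ‖⁻¹ • ξ‖ = 1 := by rw [norm_smul, norm_inv, norm_norm, inv_mul_cancel₀ hξn]
  rw [hν, inv_one, one_smul, norm_add_sq_real, inner_add_left, real_inner_self_eq_norm_sq, hν, hu,
    real_inner_comm]
  ring

/-- **Every vector off the null ray is a value of `sqMap ν` on the half-space**: for `ξ ≠ 0` with
non-degenerate Lambertian direction `m = lambertDir ν ξ`, the point `x = √‖ξ‖ · m` has `⟪x, ν⟫ > 0`
and `((2 * ⟪x, ν⟫_ℝ) • x - ‖x‖ ^ 2 • ν) = ξ`. [folklore] -/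
theorem sqMap_sqrt_smul_lambertDir {ν ξ : V} (hν : ‖ν‖ = 1) (hξ : ξ ≠ 0) (hd : lambertDir ν ξ ≠ 0) :
    0 < ⟪Real.sqrt ‖ξ‖ • lambertDir ν ξ, ν⟫_ℝ ∧ ((2 * ⟪(Real.sqrt ‖ξ‖ • lambertDir ν ξ), ν⟫_ℝ) • (Real.sqrt ‖ξ‖ • lambertDir ν ξ) - ‖(Real.sqrt ‖ξ‖ • lambertDir ν ξ)‖ ^ 2 • ν) = ξ := by
  have hν0 : ν ≠ 0 := fun h => by rw [h, norm_zero] at hν; exact zero_ne_one hν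
  have hm1 : ‖lambertDir ν ξ‖ = 1 := norm_lambertDir hd
  have hmν : 0 < ⟪lambertDir ν ξ, ν⟫_ℝ := by rw [real_inner_comm]; exact inner_lambertDir_pos hν0 hd
  have hξn : 0 < ‖ξ‖ := norm_pos_iff.2 hξ
  have hs : 0 < Real.sqrt ‖ξ‖ := Real.sqrt_pos.2 hξn
  refine ⟨by rw [inner_smul_left]; exact mul_pos hs hmν, ?_⟩
  -- the bisector `u = ν + ξ̂` and `m = u/‖u‖`
  set u : V := ‖ν‖⁻¹ • ν + ‖ξ‖⁻¹ • ξ with hu_def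
  have hu0 : u ≠ 0 := fun h => hd (lambertDir_eq_zero_iff.2 h)
  have hun : ‖u‖ ≠ 0 := norm_ne_zero_iff.2 hu0
  have hm : lambertDir ν ξ = ‖u‖⁻¹ • u := rfl
  have husq : ‖u‖ ^ 2 = 2 * ⟪u, ν⟫_ℝ := norm_sq_bisector hν hξ
  have huν : ⟪u, ν⟫_ℝ ≠ 0 := by
    intro h0; rw [h0, mul_zero, sq_eq_zero_iff, norm_eq_zero] at husq; exact hu0 husq
  -- `2⟪m, ν⟫ m = u`
  have hkey : (2 * ⟪lambertDir ν ξ, ν⟫_ℝ) • lambertDir ν ξ = u := by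
    rw [hm, inner_smul_left, smul_smul]
    have : 2 * ((starRingEnd ℝ) ‖u‖⁻¹ * ⟪u, ν⟫_ℝ) * ‖u‖⁻¹ = 1 := by
      simp only [RCLike.conj_to_real]
      field_simp
      linarith [husq]
    rw [this, one_smul]
  rw [inner_smul_left, norm_smul, Real.norm_of_nonneg hs.le, hm1, mul_one,
    Real.sq_sqrt hξn.le, smul_smul]
  simp only [RCLike.conj_to_real]
  have e1 : (2 * (Real.sqrt ‖ξ‖ * ⟪lambertDir ν ξ, ν⟫_ℝ) * Real.sqrt ‖ξ‖) • lambertDir ν ξ =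
      ‖ξ‖ • ((2 * ⟪lambertDir ν ξ, ν⟫_ℝ) • lambertDir ν ξ) := by
    rw [smul_smul]
    congr 1
    have := Real.sq_sqrt hξn.le
    nlinarith [this]
  rw [e1, hkey, hu_def, hν, inv_one, one_smul, smul_add, add_sub_cancel_left, smul_smul,
    mul_inv_cancel₀ hξn.ne', one_smul]


/-! ## The Jacobian determinant on `ℝ³` -/

/-- The matrix of `sqMapDeriv ν x` in the standard basis of `ℝ³`:
`M i j = 2⟪x, ν⟫ δ_{ij} + 2 ν_j x_i − 2 x_j ν_i`. [folklore] -/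
theorem toMatrix_sqMapDeriv (ν x : (EuclideanSpace ℝ (Fin 3))) (i j : Fin 3) :
    LinearMap.toMatrix (EuclideanSpace.basisFun (Fin 3) ℝ).toBasis (EuclideanSpace.basisFun (Fin 3) ℝ).toBasis
        (((2 * ⟪x, ν⟫_ℝ) • ContinuousLinearMap.id ℝ (EuclideanSpace ℝ (Fin 3)) +
          ((2 : ℝ) • innerSL ℝ ν).smulRight x - ((2 : ℝ) • innerSL ℝ x).smulRight ν :
            EuclideanSpace ℝ (Fin 3) →L[ℝ] EuclideanSpace ℝ (Fin 3)) :
          EuclideanSpace ℝ (Fin 3) →ₗ[ℝ] EuclideanSpace ℝ (Fin 3)) i j =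
      (2 * ⟪x, ν⟫_ℝ) * (if i = j then 1 else 0) + 2 * ν j * x i - 2 * x j * ν i := by
  rw [LinearMap.toMatrix_apply, OrthonormalBasis.coe_toBasis_repr_apply, OrthonormalBasis.coe_toBasis,
    EuclideanSpace.basisFun_apply, EuclideanSpace.basisFun_repr, ContinuousLinearMap.coe_coe,
    sqMapDeriv_apply, EuclideanSpace.inner_single_left, EuclideanSpace.inner_single_right]
  simp only [map_one, one_mul, RCLike.conj_to_real, PiLp.sub_apply, PiLp.add_apply,
    PiLp.smul_apply, smul_eq_mul, EuclideanSpace.single, PiLp.single_apply]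

/-- **The Jacobian determinant of `sqMap ν`** on `ℝ³`: `det (sqMapDeriv ν x) = 8 ‖x‖² ⟪x, ν⟫ ‖ν‖²`
(a rank-two perturbation of `2⟪x, ν⟫ · id`; computed in the standard basis). [folklore] -/
theorem det_sqMapDeriv (ν x : (EuclideanSpace ℝ (Fin 3))) :
    ((2 * ⟪x, ν⟫_ℝ) • ContinuousLinearMap.id ℝ (EuclideanSpace ℝ (Fin 3)) +
      ((2 : ℝ) • innerSL ℝ ν).smulRight x - ((2 : ℝ) • innerSL ℝ x).smulRight ν).det =
      8 * ‖x‖ ^ 2 * ⟪x, ν⟫_ℝ * ‖ν‖ ^ 2 := by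
  set Dx := ((2 * ⟪x, ν⟫_ℝ) • ContinuousLinearMap.id ℝ (EuclideanSpace ℝ (Fin 3)) +
    ((2 : ℝ) • innerSL ℝ ν).smulRight x - ((2 : ℝ) • innerSL ℝ x).smulRight ν) with hDx
  rw [ContinuousLinearMap.det, ← LinearMap.det_toMatrix (EuclideanSpace.basisFun (Fin 3) ℝ).toBasis]
  have hM : LinearMap.toMatrix (EuclideanSpace.basisFun (Fin 3) ℝ).toBasis
      (EuclideanSpace.basisFun (Fin 3) ℝ).toBasis (Dx : EuclideanSpace ℝ (Fin 3) →ₗ[ℝ] EuclideanSpace ℝ (Fin 3)) =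
      Matrix.of fun i j : Fin 3 =>
        (2 * ⟪x, ν⟫_ℝ) * (if i = j then 1 else 0) + 2 * ν j * x i - 2 * x j * ν i := by
    ext i j
    rw [hDx, toMatrix_sqMapDeriv, Matrix.of_apply]
  rw [hM, Matrix.det_fin_three]
  simp only [Matrix.of_apply, Fin.isValue, if_true, show (0 : Fin 3) ≠ 1 by decide,
    show (1 : Fin 3) ≠ 0 by decide, show (0 : Fin 3) ≠ 2 by decide, show (2 : Fin 3) ≠ 0 by decide,
    show (1 : Fin 3) ≠ 2 by decide, show (2 : Fin 3) ≠ 1 by decide, if_false, mul_zero, mul_one]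
  rw [EuclideanSpace.real_norm_sq_eq, EuclideanSpace.real_norm_sq_eq, real_inner_eq_re_inner ℝ,
    PiLp.inner_apply]
  simp only [Fin.sum_univ_three, Fin.isValue, RCLike.re_to_real, RCLike.inner_apply, conj_trivial]
  ring


/-! ## The law of the Lambertian direction of a standard Gaussian vector -/

/-- `ℝ³` has dimension `> 1`. [folklore] -/
theorem one_lt_finrank_E3 : 1 < Module.finrank ℝ (EuclideanSpace ℝ (Fin 3)) := by
  rw [finrank_euclideanSpace, Fintype.card_fin]; norm_num

/-- The degenerate noises `{ξ | lambertDir ν ξ = 0}` form a Lebesgue-null set of `ℝ³` (they lie in a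
hyperplane). [folklore] -/
theorem volume_setOf_lambertDir_eq_zero (ν : (EuclideanSpace ℝ (Fin 3))) : volume {ξ : (EuclideanSpace ℝ (Fin 3)) | lambertDir ν ξ = 0} = 0 := by
  obtain ⟨u, hu0, huν⟩ := exists_ne_zero_inner_eq_zero one_lt_finrank_E3 ν
  refine measure_mono_null (fun ξ hξ => inner_eq_zero_of_lambertDir_eq_zero huν hξ) ?_
  have hset : {ξ : (EuclideanSpace ℝ (Fin 3)) | ⟪u, ξ⟫_ℝ = 0} = ((ℝ ∙ u)ᗮ : Submodule ℝ (EuclideanSpace ℝ (Fin 3))) := by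
    ext ξ
    simp only [mem_setOf_eq, SetLike.mem_coe, Submodule.mem_orthogonal_singleton_iff_inner_right]
  show volume {ξ : (EuclideanSpace ℝ (Fin 3)) | ⟪u, ξ⟫_ℝ = 0} = 0
  rw [hset]
  refine Measure.addHaar_submodule volume _ fun htop => hu0 ?_
  have hmem : u ∈ (ℝ ∙ u)ᗮ := by rw [htop]; exact Submodule.mem_top
  exact inner_self_eq_zero.1 (Submodule.mem_orthogonal_singleton_iff_inner_right.1 hmem)

/-- The exceptional set of `sqMap ν`: zero and the degenerate noises; it is null. [folklore] -/
theorem volume_exceptional (ν : (EuclideanSpace ℝ (Fin 3))) : volume ({ξ : (EuclideanSpace ℝ (Fin 3)) | lambertDir ν ξ = 0} ∪ {0}) = 0 :=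
  measure_union_null (volume_setOf_lambertDir_eq_zero ν) (measure_singleton 0)

/-- Off the exceptional set every vector is a value of `sqMap ν` on the open half-space. [folklore] -/
theorem compl_exceptional_subset_image {ν : (EuclideanSpace ℝ (Fin 3))} (hν : ‖ν‖ = 1) :
    ({ξ : (EuclideanSpace ℝ (Fin 3)) | lambertDir ν ξ = 0} ∪ {0})ᶜ ⊆ (fun x : EuclideanSpace ℝ (Fin 3) => (2 * ⟪x, ν⟫_ℝ) • x - ‖x‖ ^ 2 • ν) '' {x : (EuclideanSpace ℝ (Fin 3)) | 0 < ⟪x, ν⟫_ℝ} := by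
  intro ξ hξ
  simp only [mem_compl_iff, mem_union, mem_setOf_eq, mem_singleton_iff, not_or] at hξ
  obtain ⟨h1, h2⟩ := sqMap_sqrt_smul_lambertDir hν hξ.2 hξ.1
  exact ⟨_, h1, h2⟩

/-- The open half-space of `ν` is measurable. [folklore] -/
theorem measurableSet_halfSpace (ν : (EuclideanSpace ℝ (Fin 3))) : MeasurableSet {x : (EuclideanSpace ℝ (Fin 3)) | 0 < ⟪x, ν⟫_ℝ} :=
  measurableSet_lt measurable_const (measurable_id.inner measurable_const)

/-- The global Maxwellian is radial. [folklore] -/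
theorem globalMaxwellian_eq_of_norm_eq {v w : (EuclideanSpace ℝ (Fin 3))} (h : ‖v‖ = ‖w‖) :
    globalMaxwellian v = globalMaxwellian w := by
  simp only [globalMaxwellian, h]

/-- **The half-angle law, up to the radial constant**: for unit `ν` and measurable `f ≥ 0`,
`∫ f(lambertDir ν ξ) dγ(ξ) = K(ν) ∫_{S²} ⟪θ, ν⟫₊ f(θ) dσ(θ)`. [folklore] -/
theorem lintegral_lambertDir_stdGaussian_aux {ν : (EuclideanSpace ℝ (Fin 3))} (hν : ‖ν‖ = 1) {f : (EuclideanSpace ℝ (Fin 3)) → ℝ≥0∞}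
    (hf : Measurable f) :
    ∫⁻ ξ, f (lambertDir ν ξ) ∂(stdGaussian (EuclideanSpace ℝ (Fin 3))) =
      (∫⁻ τ in Ioi (0 : ℝ), ENNReal.ofReal (τ ^ (Module.finrank ℝ (EuclideanSpace ℝ (Fin 3)) - 1)) * (ENNReal.ofReal (8 * τ ^ 3) * ENNReal.ofReal (globalMaxwellian ((τ ^ 2) • ν)))) * ∫⁻ θ : sphere (0 : (EuclideanSpace ℝ (Fin 3))) 1, ENNReal.ofReal ⟪(θ : (EuclideanSpace ℝ (Fin 3))), ν⟫_ℝ * f θ ∂(volume.toSphere) := by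
  set H : Set (EuclideanSpace ℝ (Fin 3)) := {x : (EuclideanSpace ℝ (Fin 3)) | 0 < ⟪x, ν⟫_ℝ} with hH
  have hHm : MeasurableSet H := measurableSet_halfSpace ν
  have hfd : Measurable fun ξ : (EuclideanSpace ℝ (Fin 3)) => f (lambertDir ν ξ) := hf.comp (measurable_const.lambertDir measurable_id)
  have hM : Measurable fun ξ : (EuclideanSpace ℝ (Fin 3)) => ENNReal.ofReal (globalMaxwellian ξ) :=
    continuous_globalMaxwellian.measurable.ennreal_ofReal
  -- Step 1: density
  have h1 : ∫⁻ ξ, f (lambertDir ν ξ) ∂(stdGaussian (EuclideanSpace ℝ (Fin 3))) =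
      ∫⁻ ξ, f (lambertDir ν ξ) * ENNReal.ofReal (globalMaxwellian ξ) := by
    rw [show stdGaussian (EuclideanSpace ℝ (Fin 3)) = _ from stdGaussian_eq_withDensity_globalMaxwellian_holds,
      lintegral_withDensity_eq_lintegral_mul _ hM hfd]
    simp only [Pi.mul_apply, mul_comm]
  -- Step 2: restrict to the image of the half-space under the square map `sq`
  set F : (EuclideanSpace ℝ (Fin 3)) → ℝ≥0∞ := fun ξ => f (lambertDir ν ξ) * ENNReal.ofReal (globalMaxwellian ξ) with hF
  set sq : EuclideanSpace ℝ (Fin 3) → EuclideanSpace ℝ (Fin 3) :=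
    fun x => (2 * ⟪x, ν⟫_ℝ) • x - ‖x‖ ^ 2 • ν with hsq
  set D : EuclideanSpace ℝ (Fin 3) → (EuclideanSpace ℝ (Fin 3) →L[ℝ] EuclideanSpace ℝ (Fin 3)) :=
    fun x => (2 * ⟪x, ν⟫_ℝ) • ContinuousLinearMap.id ℝ (EuclideanSpace ℝ (Fin 3)) +
      ((2 : ℝ) • innerSL ℝ ν).smulRight x - ((2 : ℝ) • innerSL ℝ x).smulRight ν with hD
  have hderiv : ∀ x ∈ H, HasFDerivWithinAt sq (D x) H x :=
    fun x _ => (hasFDerivAt_sqMap ν x).hasFDerivWithinAt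
  have hTm : MeasurableSet (sq '' H) := measurable_image_of_fderivWithin hHm hderiv (injOn_sqMap hν)
  have h2 : ∫⁻ ξ, F ξ = ∫⁻ ξ in sq '' H, F ξ := by
    have hnull : volume (sq '' H)ᶜ = 0 :=
      measure_mono_null (compl_subset_comm.1 (compl_exceptional_subset_image hν)) (volume_exceptional ν)
    rw [← lintegral_add_compl F hTm, setLIntegral_measure_zero _ F hnull, add_zero]
  -- Step 3: change of variables
  have h3 : ∫⁻ ξ in sq '' H, F ξ = ∫⁻ x in H, ENNReal.ofReal |(D x).det| * F (sq x) :=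
    lintegral_image_eq_lintegral_abs_det_fderiv_mul volume hHm hderiv (injOn_sqMap hν) F
  -- Step 4: the integrand on the half-space
  set G : (EuclideanSpace ℝ (Fin 3)) → ℝ≥0∞ := fun x => ENNReal.ofReal (8 * ‖x‖ ^ 2 * ⟪x, ν⟫_ℝ) *
    (f (‖x‖⁻¹ • x) * ENNReal.ofReal (globalMaxwellian ((‖x‖ ^ 2) • ν))) with hG
  have hGm : Measurable G := by
    refine (Measurable.ennreal_ofReal ?_).mul ((hf.comp ?_).mul ?_)
    · exact (measurable_const.mul (measurable_norm.pow_const 2)).mul (measurable_id.inner measurable_const)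
    · exact measurable_norm.inv.smul measurable_id
    · exact continuous_globalMaxwellian.measurable.ennreal_ofReal.comp
        ((measurable_norm.pow_const 2).smul measurable_const)
  have h4 : ∫⁻ x in H, ENNReal.ofReal |(D x).det| * F (sq x) = ∫⁻ x in H, G x := by
    refine setLIntegral_congr_fun hHm fun x hx => ?_
    have hx : 0 < ⟪x, ν⟫_ℝ := hx
    rw [hF, hG, hD, hsq]
    dsimp only
    rw [det_sqMapDeriv, hν, one_pow, mul_one, abs_of_nonneg (by positivity), lambertDir_sqMap hν hx,
      globalMaxwellian_eq_of_norm_eq (v := ((2 * ⟪x, ν⟫_ℝ) • x - ‖x‖ ^ 2 • ν)) (w := (‖x‖ ^ 2) • ν)]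
    rw [norm_sqMap hν, norm_smul, hν, mul_one, Real.norm_of_nonneg (sq_nonneg _)]
  -- Step 5: polar coordinates
  have h5 : ∫⁻ x in H, G x = ∫⁻ θ : sphere (0 : (EuclideanSpace ℝ (Fin 3))) 1, (∫⁻ τ in Ioi (0 : ℝ),
      ENNReal.ofReal (τ ^ (Module.finrank ℝ (EuclideanSpace ℝ (Fin 3)) - 1)) * H.indicator G (τ • (θ : (EuclideanSpace ℝ (Fin 3))))) ∂(volume.toSphere) := by
    rw [← lintegral_indicator hHm]
    exact lintegral_polar volume (H.indicator G) (hGm.indicator hHm)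
  -- Step 6: the inner integral
  have hrad : Measurable fun τ : ℝ => ENNReal.ofReal (τ ^ (Module.finrank ℝ (EuclideanSpace ℝ (Fin 3)) - 1)) *
      (ENNReal.ofReal (8 * τ ^ 3) * ENNReal.ofReal (globalMaxwellian ((τ ^ 2) • ν))) := by
    refine (Measurable.ennreal_ofReal (measurable_id.pow_const _)).mul
      ((Measurable.ennreal_ofReal (measurable_const.mul (measurable_id.pow_const 3))).mul ?_)
    exact continuous_globalMaxwellian.measurable.ennreal_ofReal.comp
      ((measurable_id.pow_const 2).smul measurable_const)
  have h6 : ∀ θ : sphere (0 : (EuclideanSpace ℝ (Fin 3))) 1, ∫⁻ τ in Ioi (0 : ℝ),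
      ENNReal.ofReal (τ ^ (Module.finrank ℝ (EuclideanSpace ℝ (Fin 3)) - 1)) * H.indicator G (τ • (θ : (EuclideanSpace ℝ (Fin 3)))) =
        ENNReal.ofReal ⟪(θ : (EuclideanSpace ℝ (Fin 3))), ν⟫_ℝ * f θ * (∫⁻ τ in Ioi (0 : ℝ), ENNReal.ofReal (τ ^ (Module.finrank ℝ (EuclideanSpace ℝ (Fin 3)) - 1)) * (ENNReal.ofReal (8 * τ ^ 3) * ENNReal.ofReal (globalMaxwellian ((τ ^ 2) • ν)))) := by
    intro θ
    have hθ : ‖(θ : (EuclideanSpace ℝ (Fin 3)))‖ = 1 := by simp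
    by_cases hpos : 0 < ⟪(θ : (EuclideanSpace ℝ (Fin 3))), ν⟫_ℝ
    · rw [← lintegral_const_mul _ hrad]
      refine setLIntegral_congr_fun measurableSet_Ioi fun τ hτ => ?_
      have hτ : 0 < τ := hτ
      have hmem : τ • (θ : (EuclideanSpace ℝ (Fin 3))) ∈ H := by
        show 0 < ⟪τ • (θ : (EuclideanSpace ℝ (Fin 3))), ν⟫_ℝ
        rw [inner_smul_left]; exact mul_pos hτ hpos
      have hnorm : ‖τ • (θ : (EuclideanSpace ℝ (Fin 3)))‖ = τ := by rw [norm_smul, hθ, mul_one, Real.norm_of_nonneg hτ.le]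
      rw [indicator_of_mem hmem, hG]
      dsimp only
      rw [hnorm, smul_smul, inv_mul_cancel₀ hτ.ne', one_smul, inner_smul_left]
      simp only [RCLike.conj_to_real]
      rw [show 8 * τ ^ 2 * (τ * ⟪(θ : (EuclideanSpace ℝ (Fin 3))), ν⟫_ℝ) = (8 * τ ^ 3) * ⟪(θ : (EuclideanSpace ℝ (Fin 3))), ν⟫_ℝ by ring,
        ENNReal.ofReal_mul (by positivity)]
      ring
    · have hzero : ENNReal.ofReal ⟪(θ : (EuclideanSpace ℝ (Fin 3))), ν⟫_ℝ = 0 := ENNReal.ofReal_of_nonpos (not_lt.1 hpos)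
      rw [hzero, zero_mul, zero_mul]
      refine (setLIntegral_congr_fun measurableSet_Ioi fun τ hτ => ?_).trans (lintegral_zero)
      have hτ : 0 < τ := hτ
      have hnot : τ • (θ : (EuclideanSpace ℝ (Fin 3))) ∉ H := by
        show ¬ 0 < ⟪τ • (θ : (EuclideanSpace ℝ (Fin 3))), ν⟫_ℝ
        rw [inner_smul_left]
        simp only [RCLike.conj_to_real, not_lt]
        exact mul_nonpos_of_nonneg_of_nonpos hτ.le (not_lt.1 hpos)
      rw [indicator_of_notMem hnot, mul_zero]
  -- assemble
  have hmeasθ : Measurable fun θ : sphere (0 : (EuclideanSpace ℝ (Fin 3))) 1 => ENNReal.ofReal ⟪(θ : (EuclideanSpace ℝ (Fin 3))), ν⟫_ℝ * f θ :=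
    (measurable_subtype_coe.inner measurable_const).ennreal_ofReal.mul (hf.comp measurable_subtype_coe)
  rw [h1]
  change ∫⁻ ξ, F ξ = _
  rw [h2, h3, h4, h5, lintegral_congr h6, lintegral_mul_const _ hmeasθ, mul_comm]

/-- **The half-angle cosine law**: for a unit vector `ν ∈ ℝ³` and measurable `f ≥ 0`,
`∫ f(lambertDir ν ξ) dγ(ξ) = π⁻¹ ∫_{S²} ⟪θ, ν⟫₊ f(θ) dσ(θ)` — the Lambertian direction of a standard
Gaussian vector is cosine-distributed on the hemisphere about `ν` (the constant is fixed by `f ≡ 1`: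
the Gaussian is a probability measure and the total flux is `π`, `lintegral_toSphere_cos`).
[folklore] -/
theorem lintegral_lambertDir_stdGaussian {ν : (EuclideanSpace ℝ (Fin 3))} (hν : ‖ν‖ = 1) {f : (EuclideanSpace ℝ (Fin 3)) → ℝ≥0∞}
    (hf : Measurable f) :
    ∫⁻ ξ, f (lambertDir ν ξ) ∂(stdGaussian (EuclideanSpace ℝ (Fin 3))) =
      (ENNReal.ofReal π)⁻¹ *
        ∫⁻ θ : sphere (0 : (EuclideanSpace ℝ (Fin 3))) 1, ENNReal.ofReal ⟪(θ : (EuclideanSpace ℝ (Fin 3))), ν⟫_ℝ * f θ ∂(volume.toSphere) := by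
  -- the constant from `f ≡ 1`
  have h1 := lintegral_lambertDir_stdGaussian_aux hν (f := fun _ => 1) measurable_const
  simp only [lintegral_const, measure_univ, mul_one] at h1
  have hflux : ∫⁻ θ : sphere (0 : (EuclideanSpace ℝ (Fin 3))) 1, ENNReal.ofReal ⟪(θ : (EuclideanSpace ℝ (Fin 3))), ν⟫_ℝ ∂(volume.toSphere) =
      ENNReal.ofReal π := by
    simp_rw [real_inner_comm ν]
    exact lintegral_toSphere_cos hν
  rw [hflux] at h1
  have hK : (∫⁻ τ in Ioi (0 : ℝ), ENNReal.ofReal (τ ^ (Module.finrank ℝ (EuclideanSpace ℝ (Fin 3)) - 1)) * (ENNReal.ofReal (8 * τ ^ 3) * ENNReal.ofReal (globalMaxwellian ((τ ^ 2) • ν)))) = (ENNReal.ofReal π)⁻¹ := ENNReal.eq_inv_of_mul_eq_one_left h1.symm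
  rw [lintegral_lambertDir_stdGaussian_aux hν hf, hK]


end HalfAngle

end Summit.AtomisticToContinuum.HydrodynamicLimit.Theorems
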